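import Literature.AlgebraicGeometry.HodgeTheory.CanonicalTraceCycleClass
import Literature.AlgebraicGeometry.HodgeTheory.HodgeClassOfMorphismDuality
import Literature.AlgebraicTopology.SingularHomology.FiniteDeckTransferProjectionFormula
import Literature.AlgebraicTopology.SingularHomology.FiniteQuotientInvariants
import HarnessLib

/-!
# The Gysin morphism of a finite regular cover of smooth projective varieties is the transfer
(up to a non-zero scalar; exactly, for a free deck action)

Layer `Literature/AlgebraicGeometry/HodgeTheory`; THEOREMS ONLY — no definition, no named fact, sorry-free.
Joins the tree's two push-forwards along a morphism `f : X ⟶ Y` of smooth projective complex varieties of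
the SAME dimension `n` whose map on complex points is a finite regular (Galois) covering
`c : FiniteDeckCover G X(ℂ) Y(ℂ)`, `c.proj = f(ℂ)`:

* the GYSIN morphism `f_* = PD_Y⁻¹ ∘ f(ℂ)_* ∘ PD_X : Hᵏ(X(ℂ); ℂ) → Hᵏ(Y(ℂ); ℂ)` of `HodgeTheory/ComplexGysin`
  (`complexGysin complexOrientationFamily hX hY f`, Fulton, *Young Tableaux*, App. B (5));
* the TRANSFER `τ^* : Hᵏ(X(ℂ); ℂ) → Hᵏ(Y(ℂ); ℂ)` of `AlgebraicTopology/SingularHomology/FiniteDeckTransfer`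
  (`c.transferMap k`, Hatcher §3.G: `τ^* f^* = |G|`, `f^* τ^* = Σ_g g^*`).

PROVED here:

* `transferMap_eq_smul_complexGysin` — **`τ^* = μ • f_*` in every degree**, with the scalar
  `μ = ∫_Y τ^* ω` (`ω ∈ H²ⁿ(X(ℂ))` any class with `∫_X ω = 1`), and `traceC_transferMap_ne_zero` — **`μ ≠ 0`**.
  Proof: both `τ^*` and `f_*` are adjoint to `f^*` for the Poincaré pairings — `∫_Y τ^* y ∪ x = ∫_Y τ^*(y ∪ f^* x)`
  (projection formula for the transfer, `FiniteDeckCover.transferMap_cupProduct_map_right`) and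
  `∫_Y f_* y ∪ x = ∫_X y ∪ f^* x` (`traceC_cup_complexGysin`) — and the functional `∫_Y ∘ τ^*` on the LINE
  `H²ⁿ(X(ℂ); ℂ)` is `μ · ∫_X` (`eq_traceC_smul`); the Poincaré pairing of `Y(ℂ)` is perfect
  (`isPerfPair_cupPairing_complexPoints`).  `μ ≠ 0` because `τ^*(f^* ω_Y) = |G| ω_Y ≠ 0`.
* consequences: `map_complexGysin_eq_smul_sum` — **`f^*(f_* y) = μ⁻¹ • Σ_g g^* y`**;
  `complexGysin_map_eq_smul` — **`f_*(f^* x) = (|G|/μ) • x`**; `complexGysin_map_deck` — `f_*(g^* y) = f_* y`;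
  `map_deck_eq_self_of_top` — deck transformations act trivially on `H²ⁿ(X(ℂ); ℂ)`;
  `complexBetti_map_injective_of_finiteDeckCover`, `exists_complexBetti_map_eq_of_forall_deck` (the tree's
  `map_proj_injective` / `mem_range_map_proj_of_invariant` read through `c.proj = f(ℂ)`).
* `traceC_transferMap_eq_one_of_free` / `transferMap_eq_complexGysin_of_free` — **for a FREE deck action
  `μ = 1`, i.e. `τ^* = f_*` on the nose**: a fibre of `f(ℂ)` is then a `G`-torsor of local-homeomorphism points,
  so `f(ℂ)_*[X(ℂ)] = |G| • [Y(ℂ)]` (`map_fundamentalClass_complexOrientationFamily_of_finite_fibre`, Fulton's degree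
  formula) and `|G| = ∫_Y τ^* f^* ω_Y = μ ∫_X f^* ω_Y = μ |G|`.
  (`FiniteDeckCover` does not require the action to be faithful; in general `μ = |G| / deg f(ℂ)`.)
* the Poincaré-duality test `eq_of_forall_traceC_cupProduct_eq` (`∫_Y u ∪ w = ∫_Y u' ∪ w` for all `w` ⇒ `u = u'`)
  used throughout.

Written for the cell `hodge-kum4` (lane V: Beauville's Galois cover `A × Kⁿ(A) → A^[n+1]`,
`HilbertScheme/HilbertSchemeTranslationAction`, and Kapfer–Menet's Lemma 5.4, whose printed proof uses
`Θ_* Θ^* = n⁴`, "realizes `K_{n−1}(A) × A` as a `n⁴`-fold covering of `A^[n]`"); count-neutral (0 facts).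

## References

* [HatcherAT2002] A. Hatcher, Algebraic Topology, CUP 2002, §3.G p. 321 and Prop. 3G.1 (transfer); §3.3 Prop. 3.38
  (the cup product pairing is non-singular over a field).
* [FultonYoungTableaux1997] W. Fulton, Young Tableaux, CUP 1997, App. B §B.1 (5)–(6) (Gysin maps, projection formula).
* [Fulton1998] W. Fulton, Intersection Theory, 2nd ed. 1998, Example 1.7.4 (`f_* f^* α = deg(f) α` for a finite
  flat `f`) and Lemma 19.1.2.
* [KapferMenet2018] S. Kapfer, G. Menet, Integral cohomology of the generalized Kummer fourfold, Algebraic Geometry 5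
  (2018), Lemma 5.4 (proof, p. 13 of arXiv:1607.03431).
-/

noncomputable section

open CategoryTheory
open Literature.AlgebraicTopology.SingularHomology

namespace Literature.AlgebraicGeometry.HodgeTheory

section HodgeTheory

variable {n : ℕ} {X Y : Motives.SchemeOver ℂ}

/-! ### The Poincaré-duality test -/

/-- **Poincaré-duality test**: two classes `u, u' ∈ Hᵃ(Y(ℂ); ℂ)` with `∫_Y u ∪ w = ∫_Y u' ∪ w` for every
`w ∈ Hᵈ(Y(ℂ); ℂ)`, `a + d = 2 dim Y`, are equal (the cup product pairing of the closed oriented manifold `Y(ℂ)` is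
perfect over the field `ℂ`, `isPerfPair_cupPairing_complexPoints`; `∫_Y = ε₀⁻¹⟨·, [Y(ℂ)]⟩` with `ε₀ ≠ 0`).
[cite: HatcherAT2002, §3.3 Prop. 3.38] -/
theorem eq_of_forall_traceC_cupProduct_eq (hY : Motives.IsSmoothProjective n Y) {a d : ℕ}
    (had : a + d = 2 * n) {u u' : complexBetti Y a}
    (h : ∀ w : complexBetti Y d, traceC hY (cupProduct had u w) = traceC hY (cupProduct had u' w)) :
    u = u' := by
  apply (isPerfPair_cupPairing_complexPoints complexOrientationFamily hY had).bijective_left.1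
  refine LinearMap.ext fun w ↦ ?_
  have hε : ((pointSign : ℂ))⁻¹ ≠ 0 := inv_ne_zero (Rat.cast_ne_zero.mpr pointSign_ne_zero)
  have hw := h w
  rw [traceC_apply, traceC_apply] at hw
  rw [cupPairing_apply, cupPairing_apply]
  exact mul_left_cancel₀ hε hw

/-- **Poincaré-duality test, all degrees**: `u = u'` in `Hᵃ(Y(ℂ); ℂ)` as soon as `∫_Y u ∪ w = ∫_Y u' ∪ w` for
all `w` of complementary degree (in degrees `a > 2 dim Y` the group vanishes, `subsingleton_complexBetti`).
[cite: HatcherAT2002, §3.3 Prop. 3.38 and Thm. 3.26] -/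
theorem eq_of_forall_traceC_cupProduct_eq' (hY : Motives.IsSmoothProjective n Y) {a : ℕ}
    {u u' : complexBetti Y a}
    (h : ∀ (d : ℕ) (had : a + d = 2 * n) (w : complexBetti Y d),
      traceC hY (cupProduct had u w) = traceC hY (cupProduct had u' w)) :
    u = u' := by
  by_cases ha : a ≤ 2 * n
  · exact eq_of_forall_traceC_cupProduct_eq hY (d := 2 * n - a) (by omega) (h _ _)
  · haveI := subsingleton_complexBetti hY (not_le.mp ha)
    exact Subsingleton.elim _ _

/-! ### The transfer of a finite regular cover `f(ℂ) : X(ℂ) → Y(ℂ)` against the canonical traces -/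

variable {G : Type*} [Group G] [Fintype G] [MulAction G (Motives.ComplexPoints X)]

/-- **`∫_Y τ^* z = μ · ∫_X z` on `H²ⁿ(X(ℂ); ℂ)`, `μ = ∫_Y τ^* ω`** for any `ω` with `∫_X ω = 1`: the top cohomology
of the smooth projective (connected) `X` is the line `ℂ ω` (`eq_traceC_smul`), on which every functional is a
multiple of the trace. [cite: HatcherAT2002, §3.3 Thm. 3.26 and §3.G p. 321] -/
theorem traceC_transferMap (hX : Motives.IsSmoothProjective n X) (hY : Motives.IsSmoothProjective n Y)
    (c : FiniteDeckCover G (Motives.ComplexPoints X) (Motives.ComplexPoints Y))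
    {ω : complexBetti X (2 * n)} (hω : traceC hX ω = 1) (z : complexBetti X (2 * n)) :
    traceC hY (c.transferMap (2 * n) z) = traceC hY (c.transferMap (2 * n) ω) * traceC hX z := by
  conv_lhs => rw [eq_traceC_smul hX hω z, map_smul, map_smul, smul_eq_mul]
  exact mul_comm _ _

/-- **`τ^* = μ • f_*` (transfer = scalar × Gysin), `μ = ∫_Y τ^* ω`**, for a morphism `f : X ⟶ Y` of smooth
projective varieties of the same dimension whose map on complex points is the projection of the finite regular
cover `c` (`c.proj = f(ℂ)`), in every degree `k`.  Both sides are adjoint to `f^*` for the Poincaré pairings: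
`∫_Y τ^* y ∪ x = ∫_Y τ^*(y ∪ f^* x) = μ ∫_X y ∪ f^* x = μ ∫_Y f_* y ∪ x` (projection formula for `τ^*`, the line
`H²ⁿ(X(ℂ))`, and the Gysin transposition `traceC_cup_complexGysin`); conclude by Poincaré duality on `Y(ℂ)`.
[cite: HatcherAT2002, §3.G p. 321 and Prop. 3.10] [cite: FultonYoungTableaux1997, Appendix B §B.1 (5)–(6)] -/
theorem transferMap_eq_smul_complexGysin (hX : Motives.IsSmoothProjective n X)
    (hY : Motives.IsSmoothProjective n Y) (f : X ⟶ Y)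
    (c : FiniteDeckCover G (Motives.ComplexPoints X) (Motives.ComplexPoints Y))
    (hc : c.proj = Motives.AlgPoints.mapContinuous (L := ℂ) f)
    {ω : complexBetti X (2 * n)} (hω : traceC hX ω = 1) (k : ℕ) (y : complexBetti X k) :
    c.transferMap k y =
      traceC hY (c.transferMap (2 * n) ω) • complexGysin complexOrientationFamily hX hY f rfl y := by
  refine eq_of_forall_traceC_cupProduct_eq' hY fun d hkd w ↦ ?_
  have h1 : cupProduct hkd (c.transferMap k y) w =
      c.transferMap (2 * n) (cupProduct hkd y (complexBetti.map f d w)) := by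
    rw [complexBetti.map, ← hc, c.transferMap_cupProduct_map_right hkd y w]
  rw [h1, traceC_transferMap hX hY c hω, ← traceC_cup_complexGysin hX hY f rfl hkd hkd y w,
    LinearMap.map_smul₂, map_smul, smul_eq_mul]

/-- **`μ = ∫_Y τ^* ω ≠ 0`**: otherwise `τ^* = 0` in every degree (`transferMap_eq_smul_complexGysin`), contradicting
`τ^*(f^* ω_Y) = |G| • ω_Y ≠ 0` for `ω_Y` of trace `1` (`FiniteDeckCover.transferMap_map`).
[cite: HatcherAT2002, §3.G p. 321 and Prop. 3G.1] -/
theorem traceC_transferMap_ne_zero (hX : Motives.IsSmoothProjective n X)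
    (hY : Motives.IsSmoothProjective n Y) (f : X ⟶ Y)
    (c : FiniteDeckCover G (Motives.ComplexPoints X) (Motives.ComplexPoints Y))
    (hc : c.proj = Motives.AlgPoints.mapContinuous (L := ℂ) f)
    {ω : complexBetti X (2 * n)} (hω : traceC hX ω = 1) :
    traceC hY (c.transferMap (2 * n) ω) ≠ 0 := by
  intro h0
  obtain ⟨ω', hω'⟩ := exists_traceC_eq_one hY
  have h1 := c.transferMap_map (R := ℂ) (2 * n) ω'
  rw [hc] at h1
  have h2 := transferMap_eq_smul_complexGysin hX hY f c hc hω (2 * n) (complexBetti.map f (2 * n) ω')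
  rw [h0, zero_smul] at h2
  have h3 : Fintype.card G • ω' = 0 := h1.symm.trans h2
  have h4 := congrArg (traceC hY) h3
  rw [map_nsmul, hω', map_zero, nsmul_eq_mul, mul_one] at h4
  exact Nat.cast_ne_zero.mpr Fintype.card_ne_zero h4

/-- **`∃ μ ≠ 0, τ^* = μ • f_*` in every degree** (existential packaging of `transferMap_eq_smul_complexGysin`,
`traceC_transferMap_ne_zero`). [cite: HatcherAT2002, §3.G p. 321] [cite: FultonYoungTableaux1997, Appendix B §B.1 (5)–(6)] -/
theorem exists_transferMap_eq_smul_complexGysin (hX : Motives.IsSmoothProjective n X)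
    (hY : Motives.IsSmoothProjective n Y) (f : X ⟶ Y)
    (c : FiniteDeckCover G (Motives.ComplexPoints X) (Motives.ComplexPoints Y))
    (hc : c.proj = Motives.AlgPoints.mapContinuous (L := ℂ) f) :
    ∃ μ : ℂ, μ ≠ 0 ∧ ∀ (k : ℕ) (y : complexBetti X k),
      c.transferMap k y = μ • complexGysin complexOrientationFamily hX hY f rfl y := by
  obtain ⟨ω, hω⟩ := exists_traceC_eq_one hX
  exact ⟨_, traceC_transferMap_ne_zero hX hY f c hc hω, transferMap_eq_smul_complexGysin hX hY f c hc hω⟩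

/-! ### Consequences: `f^* f_*`, `f_* f^*`, deck invariance -/

/-- **`f^*(f_* y) = μ⁻¹ • Σ_{g ∈ G} g^* y`** — the Gysin form of `f^* τ^* = Σ_g g^*`
(`FiniteDeckCover.map_proj_transferMap`). [cite: HatcherAT2002, §3.G p. 321] [cite: KapferMenet2018, Lemma 5.4 (proof) p. 13] -/
theorem map_complexGysin_eq_smul_sum (hX : Motives.IsSmoothProjective n X)
    (hY : Motives.IsSmoothProjective n Y) (f : X ⟶ Y)
    (c : FiniteDeckCover G (Motives.ComplexPoints X) (Motives.ComplexPoints Y))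
    (hc : c.proj = Motives.AlgPoints.mapContinuous (L := ℂ) f)
    {ω : complexBetti X (2 * n)} (hω : traceC hX ω = 1) (k : ℕ) (y : complexBetti X k) :
    complexBetti.map f k (complexGysin complexOrientationFamily hX hY f rfl y) =
      (traceC hY (c.transferMap (2 * n) ω))⁻¹ • ∑ g : G, singularCohomology.map ℂ ℂ (c.deck g) k y := by
  have hμ := traceC_transferMap_ne_zero hX hY f c hc hω
  have h := c.map_proj_transferMap (R := ℂ) k y
  rw [transferMap_eq_smul_complexGysin hX hY f c hc hω k y, map_smul, hc] at h
  rw [complexBetti.map, ← h, smul_smul, inv_mul_cancel₀ hμ, one_smul]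

/-- **`f_*(f^* x) = (|G|/μ) • x`** — the Gysin form of `τ^* f^* = |G|` (`FiniteDeckCover.transferMap_map`); for a
free action `|G|/μ = |G| = deg f(ℂ)` (Fulton's `f_* f^* α = deg(f) α`).
[cite: HatcherAT2002, §3.G Prop. 3G.1] [cite: Fulton1998, Example 1.7.4] -/
theorem complexGysin_map_eq_smul (hX : Motives.IsSmoothProjective n X)
    (hY : Motives.IsSmoothProjective n Y) (f : X ⟶ Y)
    (c : FiniteDeckCover G (Motives.ComplexPoints X) (Motives.ComplexPoints Y))
    (hc : c.proj = Motives.AlgPoints.mapContinuous (L := ℂ) f)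
    {ω : complexBetti X (2 * n)} (hω : traceC hX ω = 1) (k : ℕ) (x : complexBetti Y k) :
    complexGysin complexOrientationFamily hX hY f rfl (complexBetti.map f k x) =
      ((Fintype.card G : ℂ) / traceC hY (c.transferMap (2 * n) ω)) • x := by
  have hμ := traceC_transferMap_ne_zero hX hY f c hc hω
  have h := c.transferMap_map (R := ℂ) k x
  rw [hc, transferMap_eq_smul_complexGysin hX hY f c hc hω k, ← Nat.cast_smul_eq_nsmul ℂ] at h
  rw [div_eq_inv_mul, mul_smul, complexBetti.map, ← h, smul_smul, inv_mul_cancel₀ hμ, one_smul]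

/-- **`f_*(g^* y) = f_* y` for every deck transformation `g`** (`τ^* ∘ g^* = τ^*`,
`FiniteDeckCover.transferMap_map_deck`, and `μ ≠ 0`). [cite: HatcherAT2002, §3.G p. 321] -/
theorem complexGysin_map_deck (hX : Motives.IsSmoothProjective n X)
    (hY : Motives.IsSmoothProjective n Y) (f : X ⟶ Y)
    (c : FiniteDeckCover G (Motives.ComplexPoints X) (Motives.ComplexPoints Y))
    (hc : c.proj = Motives.AlgPoints.mapContinuous (L := ℂ) f) (g : G) (k : ℕ) (y : complexBetti X k) :
    complexGysin complexOrientationFamily hX hY f rfl (singularCohomology.map ℂ ℂ (c.deck g) k y) =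
      complexGysin complexOrientationFamily hX hY f rfl y := by
  obtain ⟨ω, hω⟩ := exists_traceC_eq_one hX
  have hμ := traceC_transferMap_ne_zero hX hY f c hc hω
  have h := c.transferMap_map_deck (R := ℂ) k g y
  rw [transferMap_eq_smul_complexGysin hX hY f c hc hω k,
    transferMap_eq_smul_complexGysin hX hY f c hc hω k] at h
  exact smul_right_injective _ hμ h

/-- **Deck transformations act trivially on the top cohomology `H²ⁿ(X(ℂ); ℂ)`**: `f^* ω_Y` spans the line
`H²ⁿ(X(ℂ); ℂ)` (it is non-zero, `τ^* f^* ω_Y = |G| ω_Y`), and `g^* f^* = f^*` (`f ∘ g = f`).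
[cite: HatcherAT2002, §3.G p. 321 and §3.3 Thm. 3.26] -/
theorem map_deck_eq_self_of_top (hX : Motives.IsSmoothProjective n X)
    (hY : Motives.IsSmoothProjective n Y)
    (c : FiniteDeckCover G (Motives.ComplexPoints X) (Motives.ComplexPoints Y)) (g : G)
    (u : complexBetti X (2 * n)) :
    singularCohomology.map ℂ ℂ (c.deck g) (2 * n) u = u := by
  obtain ⟨ω', hω'⟩ := exists_traceC_eq_one hY
  -- `η = f^* ω_Y` is non-zero, hence of non-zero trace, and `g^* η = η`
  set η := singularCohomology.map ℂ ℂ c.proj (2 * n) ω' with hη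
  have hη0 : traceC hX η ≠ 0 := by
    intro h0
    have h1 := c.transferMap_map (R := ℂ) (2 * n) ω'
    rw [← hη, eq_zero_of_traceC_eq_zero hX h0, map_zero] at h1
    have h2 := congrArg (traceC hY) h1
    rw [map_zero, map_nsmul, hω', nsmul_eq_mul, mul_one] at h2
    exact Nat.cast_ne_zero.mpr Fintype.card_ne_zero h2.symm
  have hgη : singularCohomology.map ℂ ℂ (c.deck g) (2 * n) η = η :=
    map_smul_map_eq_of_comp_eq c.proj (c.deck g) (ContinuousMap.ext fun e ↦ c.proj_smul g e) (2 * n) ω'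
  -- normalise `η` to trace `1` and expand `u` on the line
  have hη1 : traceC hX ((traceC hX η)⁻¹ • η) = 1 := by
    rw [map_smul, smul_eq_mul, inv_mul_cancel₀ hη0]
  rw [eq_traceC_smul hX hη1 u, map_smul, map_smul, hgη]

/-! ### Injectivity of `f^*` and descent of deck-invariant classes (through `c.proj = f(ℂ)`) -/

/-- **`f^*` is injective on `Hᵏ(Y(ℂ); ℂ)`** (`τ^* f^* = |G|`, `|G| ≠ 0` in `ℂ`; the tree's
`FiniteDeckCover.map_proj_injective`). [cite: HatcherAT2002, §3.G Prop. 3G.1] -/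
theorem complexBetti_map_injective_of_finiteDeckCover (f : X ⟶ Y)
    (c : FiniteDeckCover G (Motives.ComplexPoints X) (Motives.ComplexPoints Y))
    (hc : c.proj = Motives.AlgPoints.mapContinuous (L := ℂ) f) (k : ℕ) :
    Function.Injective (complexBetti.map f k) := by
  rw [complexBetti.map, ← hc]
  exact c.map_proj_injective k

/-- **Deck-invariant classes descend**: if `g^* y = y` for every `g ∈ G` then `y = f^* x` for some (unique) `x`
(`y = f^*(|G|⁻¹ τ^* y)`; the tree's `FiniteDeckCover.mem_range_map_proj_of_invariant`).
[cite: HatcherAT2002, §3.G p. 321] -/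
theorem exists_complexBetti_map_eq_of_forall_deck (f : X ⟶ Y)
    (c : FiniteDeckCover G (Motives.ComplexPoints X) (Motives.ComplexPoints Y))
    (hc : c.proj = Motives.AlgPoints.mapContinuous (L := ℂ) f) (k : ℕ) (y : complexBetti X k)
    (hy : ∀ g : G, singularCohomology.map ℂ ℂ (c.deck g) k y = y) :
    ∃ x : complexBetti Y k, complexBetti.map f k x = y := by
  obtain ⟨x, hx⟩ := c.mem_range_map_proj_of_invariant k y hy
  exact ⟨x, by rw [complexBetti.map, ← hc]; exact hx⟩

/-! ### Free actions: `μ = 1`, the transfer IS the Gysin morphism -/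

/-- **For a free deck action `∫_Y τ^* ω = 1`** (`ω` of trace `1`): a fibre of `f(ℂ)` through `e₀` is the
`G`-torsor `{g • e₀}` of local-homeomorphism points (`c.proj` is a covering map), so
`f(ℂ)_*[X(ℂ)] = |G| • [Y(ℂ)]` (Fulton's degree formula, `map_fundamentalClass_complexOrientationFamily_of_finite_fibre`)
and `∫_X f^* ω_Y = |G|`; then `|G| = ∫_Y τ^* f^* ω_Y = μ · ∫_X f^* ω_Y = μ |G|`.
[cite: Fulton1998, Lemma 19.1.2 and Example 1.7.4] [cite: HatcherAT2002, §3.G p. 321] -/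
theorem traceC_transferMap_eq_one_of_free (hX : Motives.IsSmoothProjective n X)
    (hY : Motives.IsSmoothProjective n Y) (f : X ⟶ Y)
    (c : FiniteDeckCover G (Motives.ComplexPoints X) (Motives.ComplexPoints Y))
    (hc : c.proj = Motives.AlgPoints.mapContinuous (L := ℂ) f) {e₀ : Motives.ComplexPoints X}
    (hfree : ∀ g : G, g • e₀ = e₀ → g = 1) {ω : complexBetti X (2 * n)} (hω : traceC hX ω = 1) :
    traceC hY (c.transferMap (2 * n) ω) = 1 := by
  classical
  -- the fibre through `e₀` is the torsor `g ↦ g • e₀`, enumerated by `Fin |G|` (universe bookkeeping)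
  set v : Fin (Fintype.card G) → Motives.ComplexPoints X := fun i ↦ (Fintype.equivFin G).symm i • e₀ with hvdef
  have hv0 : Function.Injective fun g : G ↦ g • e₀ := by
    intro g g' h
    have h' : (g'⁻¹ * g) • e₀ = e₀ := by
      have h'' : g • e₀ = g' • e₀ := h
      rw [mul_smul, h'', inv_smul_smul]
    exact (inv_mul_eq_one.mp (hfree _ h')).symm
  have hv : Function.Injective v := hv0.comp (Fintype.equivFin G).symm.injective
  have hfibre : (Motives.AlgPoints.map f) ⁻¹' {c.proj e₀} = Set.range v := by
    ext e
    simp only [Set.mem_preimage, Set.mem_singleton_iff, Set.mem_range, hvdef]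
    constructor
    · intro he
      have he' : c.proj e = c.proj e₀ := by rw [← he, hc]; rfl
      obtain ⟨g, hg⟩ := c.exists_smul_of_proj_eq he'
      exact ⟨Fintype.equivFin G g, by rw [Equiv.symm_apply_apply]; exact hg.symm⟩
    · rintro ⟨i, rfl⟩
      rw [← c.proj_smul ((Fintype.equivFin G).symm i) e₀, hc]
      rfl
  have hloc : ∀ i : Fin (Fintype.card G),
      ∃ e : OpenPartialHomeomorph (Motives.ComplexPoints X) (Motives.ComplexPoints Y),
      v i ∈ e.source ∧ (e : Motives.ComplexPoints X → Motives.ComplexPoints Y) = Motives.AlgPoints.map f := by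
    intro i
    obtain ⟨e, he, hfe⟩ := c.isCoveringMap_proj.isLocalHomeomorph (v i)
    refine ⟨e, he, ?_⟩
    rw [← hfe, hc]
    rfl
  have hdeg := map_fundamentalClass_complexOrientationFamily_of_finite_fibre hX hY f hv hfibre hloc
  rw [Fintype.card_fin] at hdeg
  obtain ⟨ω', hω'⟩ := exists_traceC_eq_one hY
  have h1 : traceC hX (complexBetti.map f (2 * n) ω') = Fintype.card G := by
    rw [traceC_map_of_map_fundamentalClass hX hY f hdeg, hω', mul_one]
  have h2 := traceC_transferMap hX hY c hω (complexBetti.map f (2 * n) ω')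
  have h3 : c.transferMap (2 * n) (complexBetti.map f (2 * n) ω') = Fintype.card G • ω' := by
    rw [complexBetti.map, ← hc]
    exact c.transferMap_map (2 * n) ω'
  rw [h1, h3, map_nsmul, hω', nsmul_eq_mul, mul_one] at h2
  have hG : (Fintype.card G : ℂ) ≠ 0 := Nat.cast_ne_zero.mpr Fintype.card_ne_zero
  exact mul_left_injective₀ hG (h2.symm.trans (one_mul _).symm)

/-- **For a free deck action the transfer is the Gysin morphism: `τ^* = f_*`** in every degree.
[cite: Fulton1998, Example 1.7.4] [cite: HatcherAT2002, §3.G p. 321] [cite: FultonYoungTableaux1997, Appendix B §B.1 (5)] -/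
theorem transferMap_eq_complexGysin_of_free (hX : Motives.IsSmoothProjective n X)
    (hY : Motives.IsSmoothProjective n Y) (f : X ⟶ Y)
    (c : FiniteDeckCover G (Motives.ComplexPoints X) (Motives.ComplexPoints Y))
    (hc : c.proj = Motives.AlgPoints.mapContinuous (L := ℂ) f) {e₀ : Motives.ComplexPoints X}
    (hfree : ∀ g : G, g • e₀ = e₀ → g = 1) (k : ℕ) (y : complexBetti X k) :
    c.transferMap k y = complexGysin complexOrientationFamily hX hY f rfl y := by
  obtain ⟨ω, hω⟩ := exists_traceC_eq_one hX
  rw [transferMap_eq_smul_complexGysin hX hY f c hc hω k y,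
    traceC_transferMap_eq_one_of_free hX hY f c hc hfree hω, one_smul]

/-- **Free action: `f^*(f_* y) = Σ_g g^* y`.** [cite: HatcherAT2002, §3.G p. 321] [cite: KapferMenet2018, Lemma 5.4 (proof) p. 13] -/
theorem map_complexGysin_eq_sum_of_free (hX : Motives.IsSmoothProjective n X)
    (hY : Motives.IsSmoothProjective n Y) (f : X ⟶ Y)
    (c : FiniteDeckCover G (Motives.ComplexPoints X) (Motives.ComplexPoints Y))
    (hc : c.proj = Motives.AlgPoints.mapContinuous (L := ℂ) f) {e₀ : Motives.ComplexPoints X}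
    (hfree : ∀ g : G, g • e₀ = e₀ → g = 1) (k : ℕ) (y : complexBetti X k) :
    complexBetti.map f k (complexGysin complexOrientationFamily hX hY f rfl y) =
      ∑ g : G, singularCohomology.map ℂ ℂ (c.deck g) k y := by
  rw [← transferMap_eq_complexGysin_of_free hX hY f c hc hfree k y, complexBetti.map, ← hc]
  exact c.map_proj_transferMap k y

/-- **Free action: `f_*(f^* x) = |G| • x`** (`deg f(ℂ) = |G|`). [cite: Fulton1998, Example 1.7.4] [cite: HatcherAT2002, §3.G Prop. 3G.1] -/
theorem complexGysin_map_eq_card_smul_of_free (hX : Motives.IsSmoothProjective n X)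
    (hY : Motives.IsSmoothProjective n Y) (f : X ⟶ Y)
    (c : FiniteDeckCover G (Motives.ComplexPoints X) (Motives.ComplexPoints Y))
    (hc : c.proj = Motives.AlgPoints.mapContinuous (L := ℂ) f) {e₀ : Motives.ComplexPoints X}
    (hfree : ∀ g : G, g • e₀ = e₀ → g = 1) (k : ℕ) (x : complexBetti Y k) :
    complexGysin complexOrientationFamily hX hY f rfl (complexBetti.map f k x) = (Fintype.card G : ℂ) • x := by
  rw [← transferMap_eq_complexGysin_of_free hX hY f c hc hfree k, complexBetti.map, ← hc,
    Nat.cast_smul_eq_nsmul]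
  exact c.transferMap_map k x

end HodgeTheory

end Literature.AlgebraicGeometry.HodgeTheory

end
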